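import Mathlib
import HarnessLib
import Summits.HubbardSuperconductivity.HubbardSuperconductivity.Theorems.KLProgrammeC4aPPKernelWindow
import Summits.HubbardSuperconductivity.HubbardSuperconductivity.Theorems.KLProgrammeC4aPPKernelTrueProductForm

/-!
# Route `KLProgramme` — crux C4a, S3 brick (B4) «(B4)-UMK1», «(B3)-K MODEL WINDOW» part 1: the signed pp kernel split at the model's Matsubara window,
# `P = P_M + R_M`, with COUNT-FREE tails `|R_M| ≤ 2/ω_M`, `|∂ᵤR_M|, |∂ₑR_M| ≤ (8B₁/Λ + (5/2)(β/π))/ω_M` (`ω_M = (2M+1)π/β`)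

Cell `gate-hubbard-kl`, seat hubbard-kl-k3c3-p1 (g18; row «δμ-flow with klAngularMean constant piece»).  Kernel side of the (U1) chain of stub (C)
`stub_twoLeg_curvature` (ENGINE stmt-HubbardSuperconductivity-20437): every landed (U1) kernel row (`…C4aPPKernelTrue*`, `…FarS*`, `…Mid*`, the one-calls) is
about the ALL-FREQUENCY signed kernel `P = ppTrueKernel β Λ` (`…C4aPPKernelTrueProductForm`), while the lattice model keeps the `2M` fermionic frequencies
`π(2n+1)/β`, `n ∈ [−M, M)` (`Literature…HubbardFreeCovariance.matsubaraFreq`).  This is the K-third of the (B3) identification ((R383): `(w, Y, K)` ↔ the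
co-moving bubble) on the kernel side, item «finite Matsubara window» of memo U1-CAUSTIC-SUP §(b); part 2 (`…C4aPPKernelModelWindowSum`) identifies the
model's frequency sum with `P_M = P − R_M` and states the remainder law.
* §1 `ppKernelSummand(Du)` (one term of `P` / of `∂ᵤP`), `ppWindowKernel(Du)` (`P_M = (2/β)Σ_{n<M}`), `ppTailKernel(Du)` (`R_M = (2/β)Σ_{n≥M}`);
  `ppTrueKernel_eq_window_add_tail` (`P = P_M + R_M`), `ppTrueKernelDu_eq_window_add_tail`, `ppWindowKernel_mul` / `ppTailKernel_mul` (`P_M·(e+u) = N_M`,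
  `R_M·(e+u) = N_tail`: the window/tail numerators of `…C4aPPKernelWindow`), symmetry in the two levels;
* §2 `hasDerivAt_ppWindowKernel_u/_e`, **`hasDerivAt_ppTailKernel_u/_e`** (`∂ᵤR_M = ppTailKernelDu`), `contDiff_one_ppTailKernel`, joint continuity of `R_M`, `∂ᵤR_M`;
* §3 COUNT-FREE TAILS (majorant `1/ωₙ² ≤ 2/(ωₙ²+ω_M²)` on `n ≥ M`, summed over ALL `n` by `Σₙ 1/(ωₙ²+a²) = β·tanh(βa/2)/(4a)`): `abs_tsum_tail_le_of_inv_sq`,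
  **`abs_ppTailKernel_le`** (`|R_M| ≤ 2/ω_M`), **`abs_ppTailKernelDu_le`** (`|∂ᵤR_M| ≤ (8B₁/Λ + (5/2)(β/π))/ω_M`), `abs_deriv_ppTailKernel_u_le/_e_le`, `div_ppFreq_eq`
  (`C/ω_M = Cβ/((2M+1)π)`: at `M ≥ klEngM₃ β U L` these are far below every currency of (C)).
Pure real analysis on Literature objects; nothing asserts (C), K3, the window or superconductivity.
References: BGM 2006 §2.1 (2.3)–(2.4), §2.4 (2.36) [cite: BenfattoGiulianiMastropietro2006]; Salmhofer 1999 §4.2.4 (4.63), §4.2.5 (4.70) [cite: Salmhofer1999].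
-/

noncomputable section

namespace Summit.HubbardSuperconductivity.HubbardSuperconductivity.Theorems.C4a

set_option linter.dupNamespace false -- summit = problem name (single-conjunct summit), D-0017

open Real Filter Set Finset Complex
open scoped Topology
open Literature.MathematicalPhysics.QuantumLattice Literature.Analysis.SpecialFunctions

/-! ## §1 Summands, window and tail of the signed kernel -/

/-- One summand of `P`: `W(ωₙ,e)W(ωₙ,u)(eu+ωₙ²)/((ωₙ²+e²)(ωₙ²+u²))`. -/
def ppKernelSummand (β Λ e u : ℝ) (n : ℕ) : ℝ :=
  uvWeightFn Λ (ppFreq β n) e * uvWeightFn Λ (ppFreq β n) u * ((e * u + ppFreq β n ^ 2) / ((ppFreq β n ^ 2 + e ^ 2) * (ppFreq β n ^ 2 + u ^ 2)))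

/-- One summand of `∂ᵤP`. -/
def ppKernelSummandDu (β Λ e u : ℝ) (n : ℕ) : ℝ :=
  uvWeightFn Λ (ppFreq β n) e *
    ((uvWeightFnD1 Λ (ppFreq β n) u * (e * u + ppFreq β n ^ 2) + uvWeightFn Λ (ppFreq β n) u * e) / ((ppFreq β n ^ 2 + e ^ 2) * (ppFreq β n ^ 2 + u ^ 2)) -
      uvWeightFn Λ (ppFreq β n) u * (e * u + ppFreq β n ^ 2) * (2 * u) / ((ppFreq β n ^ 2 + e ^ 2) * (ppFreq β n ^ 2 + u ^ 2) ^ 2))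

/-- The WINDOW kernel `P_M = (2/β)Σ_{n<M}` (the model's `2M` frequencies, paired). -/
def ppWindowKernel (β Λ : ℝ) (M : ℕ) (e u : ℝ) : ℝ := 2 / β * ∑ n ∈ Finset.range M, ppKernelSummand β Λ e u n

/-- `∂ᵤP_M`. -/
def ppWindowKernelDu (β Λ : ℝ) (M : ℕ) (e u : ℝ) : ℝ := 2 / β * ∑ n ∈ Finset.range M, ppKernelSummandDu β Λ e u n

/-- The TAIL kernel `R_M = (2/β)Σ_{n≥M}`. -/
def ppTailKernel (β Λ : ℝ) (M : ℕ) (e u : ℝ) : ℝ := 2 / β * ∑' n : ℕ, ppKernelSummand β Λ e u (n + M)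

/-- `∂ᵤR_M`. -/
def ppTailKernelDu (β Λ : ℝ) (M : ℕ) (e u : ℝ) : ℝ := 2 / β * ∑' n : ℕ, ppKernelSummandDu β Λ e u (n + M)

/-- `P = (2/β)Σ ppKernelSummand`. [folklore] -/
theorem ppTrueKernel_eq_tsum_ppKernelSummand (β Λ e u : ℝ) : ppTrueKernel β Λ e u = 2 / β * ∑' n : ℕ, ppKernelSummand β Λ e u n := rfl

/-- `∂ᵤP = (2/β)Σ ppKernelSummandDu`. [folklore] -/
theorem ppTrueKernelDu_eq_tsum_ppKernelSummandDu (β Λ e u : ℝ) : ppTrueKernelDu β Λ e u = 2 / β * ∑' n : ℕ, ppKernelSummandDu β Λ e u n := rfl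

/-- The summand is symmetric in the two levels. [folklore] -/
theorem ppKernelSummand_symm (β Λ e u : ℝ) (n : ℕ) : ppKernelSummand β Λ e u n = ppKernelSummand β Λ u e n := by
  unfold ppKernelSummand; ring

/-- `|summand| ≤ 2/ωₙ²`. [folklore] -/
theorem abs_ppKernelSummand_le {β : ℝ} (hβ : 0 < β) (Λ e u : ℝ) (n : ℕ) :
    |ppKernelSummand β Λ e u n| ≤ 2 * (1 / (ppFreq β n ^ 2 + 0 ^ 2)) :=
  abs_ppTrueKernel_summand_le hβ Λ e u n

/-- `|∂ᵤ summand| ≤ (8B₁/Λ + (5/2)(β/π))/ωₙ²`. [folklore] -/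
theorem abs_ppKernelSummandDu_le {β Λ : ℝ} (hβ : 0 < β) (hΛ : 0 < Λ) {B₁ : ℝ} (hB₁ : ∀ x, |deriv salmhoferCutoff x| ≤ B₁) (e u : ℝ) (n : ℕ) :
    |ppKernelSummandDu β Λ e u n| ≤ (8 * B₁ / Λ + 5 / 2 * (β / π)) * (1 / (ppFreq β n ^ 2 + 0 ^ 2)) :=
  abs_ppTrueKernelDu_summand_le hβ hΛ hB₁ e u n

/-- Summability of the summands. [folklore] -/
theorem summable_ppKernelSummand {β : ℝ} (hβ : 0 < β) (Λ e u : ℝ) : Summable (ppKernelSummand β Λ e u) :=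
  summable_ppTrueKernel hβ Λ e u

/-- Summability of the `∂ᵤ` summands. [folklore] -/
theorem summable_ppKernelSummandDu {β Λ : ℝ} (hβ : 0 < β) (hΛ : 0 < Λ) {B₁ : ℝ} (hB₁ : ∀ x, |deriv salmhoferCutoff x| ≤ B₁) (e u : ℝ) :
    Summable (ppKernelSummandDu β Λ e u) :=
  Summable.of_norm_bounded ((summable_one_div_ppFreq_sq_add_sq hβ 0).mul_left _) fun n => by
    rw [Real.norm_eq_abs]; exact abs_ppKernelSummandDu_le hβ hΛ hB₁ e u n

/-- **Window + tail**: `P = P_M + R_M`. [cite: BenfattoGiulianiMastropietro2006, §2.1 (2.3)-(2.4)] -/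
theorem ppTrueKernel_eq_window_add_tail {β : ℝ} (hβ : 0 < β) (Λ : ℝ) (M : ℕ) (e u : ℝ) :
    ppTrueKernel β Λ e u = ppWindowKernel β Λ M e u + ppTailKernel β Λ M e u := by
  rw [ppTrueKernel_eq_tsum_ppKernelSummand, ppWindowKernel, ppTailKernel, ← mul_add, (summable_ppKernelSummand hβ Λ e u).sum_add_tsum_nat_add M]

/-- **Window + tail for `∂ᵤ`**: `∂ᵤP = ∂ᵤP_M + ∂ᵤR_M` (as series). [cite: BenfattoGiulianiMastropietro2006, §2.1 (2.3)-(2.4)] -/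
theorem ppTrueKernelDu_eq_window_add_tail {β Λ : ℝ} (hβ : 0 < β) (hΛ : 0 < Λ) {B₁ : ℝ} (hB₁ : ∀ x, |deriv salmhoferCutoff x| ≤ B₁) (M : ℕ) (e u : ℝ) :
    ppTrueKernelDu β Λ e u = ppWindowKernelDu β Λ M e u + ppTailKernelDu β Λ M e u := by
  rw [ppTrueKernelDu_eq_tsum_ppKernelSummandDu, ppWindowKernelDu, ppTailKernelDu, ← mul_add,
    (summable_ppKernelSummandDu hβ hΛ hB₁ e u).sum_add_tsum_nat_add M]

/-- The window is symmetric in the two levels. [folklore] -/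
theorem ppWindowKernel_symm (β Λ : ℝ) (M : ℕ) (e u : ℝ) : ppWindowKernel β Λ M e u = ppWindowKernel β Λ M u e := by
  unfold ppWindowKernel; congr 1; exact Finset.sum_congr rfl fun n _ => ppKernelSummand_symm β Λ e u _

/-- The tail is symmetric in the two levels. [folklore] -/
theorem ppTailKernel_symm (β Λ : ℝ) (M : ℕ) (e u : ℝ) : ppTailKernel β Λ M e u = ppTailKernel β Λ M u e := by
  unfold ppTailKernel; congr 1; exact tsum_congr fun n => ppKernelSummand_symm β Λ e u _

/-- `summand·(e+u) = ppSummand` (`(eu+ω²)(e+u) = e(ω²+u²) + u(ω²+e²)`). [cite: BenfattoGiulianiMastropietro2006, §2.1 (2.3)] -/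
theorem ppKernelSummand_mul {β : ℝ} (hβ : 0 < β) (Λ e u : ℝ) (n : ℕ) : ppKernelSummand β Λ e u n * (e + u) = ppSummand β Λ e u n := by
  have hω := ppFreq_pos hβ n
  have h1 : ppFreq β n ^ 2 + e ^ 2 ≠ 0 := by positivity
  have h2 : ppFreq β n ^ 2 + u ^ 2 ≠ 0 := by positivity
  have key : (e * u + ppFreq β n ^ 2) / ((ppFreq β n ^ 2 + e ^ 2) * (ppFreq β n ^ 2 + u ^ 2)) * (e + u) =
      e / (ppFreq β n ^ 2 + e ^ 2) + u / (ppFreq β n ^ 2 + u ^ 2) := by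
    rw [div_add_div _ _ h1 h2, div_mul_eq_mul_div]
    congr 1
    ring
  unfold ppKernelSummand ppSummand
  rw [mul_assoc, key]

/-- **`P_M·(e+u) = N_M`** (the window numerator of `…C4aPPKernelWindow`). [cite: BenfattoGiulianiMastropietro2006, §2.1 (2.3)] -/
theorem ppWindowKernel_mul {β : ℝ} (hβ : 0 < β) (Λ : ℝ) (M : ℕ) (e u : ℝ) :
    ppWindowKernel β Λ M e u * (e + u) = ppWindowNumerator β Λ M e u := by
  unfold ppWindowKernel ppWindowNumerator
  rw [mul_assoc, Finset.sum_mul]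
  congr 1
  exact Finset.sum_congr rfl fun n _ => ppKernelSummand_mul hβ Λ e u n

/-- **`R_M·(e+u) = N_tail`** (the tail numerator of `…C4aPPKernelWindow`). [cite: BenfattoGiulianiMastropietro2006, §2.1 (2.3)] -/
theorem ppTailKernel_mul {β : ℝ} (hβ : 0 < β) (Λ : ℝ) (M : ℕ) (e u : ℝ) :
    ppTailKernel β Λ M e u * (e + u) = ppTailNumerator β Λ M e u := by
  unfold ppTailKernel ppTailNumerator
  rw [mul_assoc, ← tsum_mul_right]
  congr 1
  exact tsum_congr fun n => ppKernelSummand_mul hβ Λ e u _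

/-! ## §2 Derivatives and continuity of window and tail -/

/-- **`∂ᵤ` of one summand.** [cite: BenfattoGiulianiMastropietro2006, §2.4 (2.36)] -/
theorem hasDerivAt_ppKernelSummand_u {β : ℝ} (hβ : 0 < β) (Λ e : ℝ) (n : ℕ) (v : ℝ) :
    HasDerivAt (fun y => ppKernelSummand β Λ e y n) (ppKernelSummandDu β Λ e v n) v := by
  have hω := ppFreq_pos hβ n
  have h1 : (ppFreq β n ^ 2 + e ^ 2) ≠ 0 := by positivity
  have h2 : (ppFreq β n ^ 2 + v ^ 2) ≠ 0 := by positivity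
  have hW : HasDerivAt (fun y => uvWeightFn Λ (ppFreq β n) y) (uvWeightFnD1 Λ (ppFreq β n) v) v := hasDerivAt_uvWeightFn Λ (ppFreq β n) v
  have hN : HasDerivAt (fun y : ℝ => e * y + ppFreq β n ^ 2) e v := by
    simpa using ((hasDerivAt_id v).const_mul e).add_const (ppFreq β n ^ 2)
  have hD : HasDerivAt (fun y : ℝ => (ppFreq β n ^ 2 + e ^ 2) * (ppFreq β n ^ 2 + y ^ 2)) ((ppFreq β n ^ 2 + e ^ 2) * (2 * v)) v := by
    have h0 := ((hasDerivAt_pow 2 v).const_add (ppFreq β n ^ 2)).const_mul (ppFreq β n ^ 2 + e ^ 2)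
    refine h0.congr_deriv ?_
    simp
  have hQ := hN.div hD (mul_ne_zero h1 h2)
  have h := (hW.fun_mul hQ).const_mul (uvWeightFn Λ (ppFreq β n) e)
  refine (h.congr_of_eventuallyEq (Eventually.of_forall fun y => by unfold ppKernelSummand; simp only [Pi.div_apply]; ring)).congr_deriv ?_
  unfold ppKernelSummandDu
  simp only [Pi.div_apply]
  field_simp
  ring

/-- **`∂ᵤP_M`** (finite sum). [cite: BenfattoGiulianiMastropietro2006, §2.4 (2.36)] -/
theorem hasDerivAt_ppWindowKernel_u {β : ℝ} (hβ : 0 < β) (Λ : ℝ) (M : ℕ) (e u : ℝ) :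
    HasDerivAt (fun v => ppWindowKernel β Λ M e v) (ppWindowKernelDu β Λ M e u) u := by
  unfold ppWindowKernel ppWindowKernelDu
  exact (HasDerivAt.fun_sum fun n _ => hasDerivAt_ppKernelSummand_u hβ Λ e n u).const_mul _

/-- **`∂ᵤR_M = ppTailKernelDu`** (`R_M = P − P_M`). [cite: BenfattoGiulianiMastropietro2006, §2.4 (2.36)] -/
theorem hasDerivAt_ppTailKernel_u {β Λ : ℝ} (hβ : 0 < β) (hΛ : 0 < Λ) {B₁ : ℝ} (hB₁ : ∀ x, |deriv salmhoferCutoff x| ≤ B₁) (M : ℕ) (e u : ℝ) :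
    HasDerivAt (fun v => ppTailKernel β Λ M e v) (ppTailKernelDu β Λ M e u) u := by
  have hfun : (fun v => ppTailKernel β Λ M e v) = fun v => ppTrueKernel β Λ e v - ppWindowKernel β Λ M e v := by
    funext v; rw [ppTrueKernel_eq_window_add_tail hβ Λ M e v]; ring
  have hval : ppTailKernelDu β Λ M e u = ppTrueKernelDu β Λ e u - ppWindowKernelDu β Λ M e u := by
    rw [ppTrueKernelDu_eq_window_add_tail hβ hΛ hB₁ M e u]; ring
  rw [hfun, hval]
  exact (hasDerivAt_ppTrueKernel_u hβ hΛ hB₁ e u).sub (hasDerivAt_ppWindowKernel_u hβ Λ M e u)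

/-- **`∂ₑR_M`** = `ppTailKernelDu β Λ M u e` by symmetry. [cite: BenfattoGiulianiMastropietro2006, §2.4 (2.36)] -/
theorem hasDerivAt_ppTailKernel_e {β Λ : ℝ} (hβ : 0 < β) (hΛ : 0 < Λ) {B₁ : ℝ} (hB₁ : ∀ x, |deriv salmhoferCutoff x| ≤ B₁) (M : ℕ) (e u : ℝ) :
    HasDerivAt (fun x => ppTailKernel β Λ M x u) (ppTailKernelDu β Λ M u e) e := by
  have hfun : (fun x => ppTailKernel β Λ M x u) = fun x => ppTailKernel β Λ M u x := funext fun x => ppTailKernel_symm β Λ M x u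
  rw [hfun]; exact hasDerivAt_ppTailKernel_u hβ hΛ hB₁ M u e

/-- **`∂ₑP_M`** = `ppWindowKernelDu β Λ M u e` by symmetry. [cite: BenfattoGiulianiMastropietro2006, §2.4 (2.36)] -/
theorem hasDerivAt_ppWindowKernel_e {β : ℝ} (hβ : 0 < β) (Λ : ℝ) (M : ℕ) (e u : ℝ) :
    HasDerivAt (fun x => ppWindowKernel β Λ M x u) (ppWindowKernelDu β Λ M u e) e := by
  have hfun : (fun x => ppWindowKernel β Λ M x u) = fun x => ppWindowKernel β Λ M u x := funext fun x => ppWindowKernel_symm β Λ M x u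
  rw [hfun]; exact hasDerivAt_ppWindowKernel_u hβ Λ M u e

/-- `deriv` form of `∂ᵤR_M`. [cite: BenfattoGiulianiMastropietro2006, §2.4 (2.36)] -/
theorem deriv_ppTailKernel_u {β Λ : ℝ} (hβ : 0 < β) (hΛ : 0 < Λ) {B₁ : ℝ} (hB₁ : ∀ x, |deriv salmhoferCutoff x| ≤ B₁) (M : ℕ) (e u : ℝ) :
    deriv (fun v => ppTailKernel β Λ M e v) u = ppTailKernelDu β Λ M e u :=
  (hasDerivAt_ppTailKernel_u hβ hΛ hB₁ M e u).deriv

/-- `u ↦ R_M(e,u)` is `C¹`. [cite: BenfattoGiulianiMastropietro2006, §2.4 (2.36)] -/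
theorem contDiff_one_ppTailKernel {β Λ : ℝ} (hβ : 0 < β) (hΛ : 0 < Λ) {B₁ : ℝ} (hB₁ : ∀ x, |deriv salmhoferCutoff x| ≤ B₁) (M : ℕ) (e : ℝ) :
    ContDiff ℝ 1 (fun u : ℝ => ppTailKernel β Λ M e u) := by
  have hfun : (fun v => ppTailKernel β Λ M e v) = fun v => ppTrueKernel β Λ e v - ppWindowKernel β Λ M e v := by
    funext v; rw [ppTrueKernel_eq_window_add_tail hβ Λ M e v]; ring
  rw [hfun]
  refine (contDiff_one_ppTrueKernel hβ hΛ hB₁ e).sub ?_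
  unfold ppWindowKernel
  refine contDiff_const.mul (ContDiff.sum fun n _ => ?_)
  have hd : ∀ v, HasDerivAt (fun y => ppKernelSummand β Λ e y n) (ppKernelSummandDu β Λ e v n) v := hasDerivAt_ppKernelSummand_u hβ Λ e n
  have hderiv : deriv (fun y => ppKernelSummand β Λ e y n) = fun v => ppKernelSummandDu β Λ e v n := funext fun v => (hd v).deriv
  rw [contDiff_one_iff_deriv, hderiv]
  refine ⟨fun v => (hd v).differentiableAt, ?_⟩
  have hω := ppFreq_pos hβ n
  have hW : Continuous fun u : ℝ => uvWeightFn Λ (ppFreq β n) u := continuous_uvWeightFn_level Λ _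
  have hW1 : Continuous fun u : ℝ => uvWeightFnD1 Λ (ppFreq β n) u := continuous_uvWeightFnD1_level Λ _
  have hne1 : ∀ u : ℝ, (ppFreq β n ^ 2 + e ^ 2) * (ppFreq β n ^ 2 + u ^ 2) ≠ 0 := fun u => by positivity
  have hne2 : ∀ u : ℝ, (ppFreq β n ^ 2 + e ^ 2) * (ppFreq β n ^ 2 + u ^ 2) ^ 2 ≠ 0 := fun u => by positivity
  unfold ppKernelSummandDu
  exact continuous_const.mul ((Continuous.div ((hW1.mul (by fun_prop)).add (hW.mul continuous_const)) (by fun_prop) hne1).sub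
    (Continuous.div ((hW.mul (by fun_prop)).mul (by fun_prop)) (by fun_prop) hne2))

/-- The summand is jointly continuous in the two levels. [folklore] -/
theorem continuous_ppKernelSummand₂ {β : ℝ} (hβ : 0 < β) (Λ : ℝ) (n : ℕ) :
    Continuous fun p : ℝ × ℝ => ppKernelSummand β Λ p.1 p.2 n := by
  have hω := ppFreq_pos hβ n
  have hWe : Continuous fun p : ℝ × ℝ => uvWeightFn Λ (ppFreq β n) p.1 := (continuous_uvWeightFn_level Λ _).comp continuous_fst
  have hWu : Continuous fun p : ℝ × ℝ => uvWeightFn Λ (ppFreq β n) p.2 := (continuous_uvWeightFn_level Λ _).comp continuous_snd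
  have hne : ∀ p : ℝ × ℝ, (ppFreq β n ^ 2 + p.1 ^ 2) * (ppFreq β n ^ 2 + p.2 ^ 2) ≠ 0 := fun p => by positivity
  unfold ppKernelSummand
  exact (hWe.mul hWu).mul (Continuous.div (by fun_prop) (by fun_prop) hne)

/-- The `∂ᵤ` summand is jointly continuous in the two levels. [folklore] -/
theorem continuous_ppKernelSummandDu₂ {β : ℝ} (hβ : 0 < β) (Λ : ℝ) (n : ℕ) :
    Continuous fun p : ℝ × ℝ => ppKernelSummandDu β Λ p.1 p.2 n := by
  have hω := ppFreq_pos hβ n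
  have hWe : Continuous fun p : ℝ × ℝ => uvWeightFn Λ (ppFreq β n) p.1 := (continuous_uvWeightFn_level Λ _).comp continuous_fst
  have hWu : Continuous fun p : ℝ × ℝ => uvWeightFn Λ (ppFreq β n) p.2 := (continuous_uvWeightFn_level Λ _).comp continuous_snd
  have hW1 : Continuous fun p : ℝ × ℝ => uvWeightFnD1 Λ (ppFreq β n) p.2 := (continuous_uvWeightFnD1_level Λ _).comp continuous_snd
  have hne1 : ∀ p : ℝ × ℝ, (ppFreq β n ^ 2 + p.1 ^ 2) * (ppFreq β n ^ 2 + p.2 ^ 2) ≠ 0 := fun p => by positivity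
  have hne2 : ∀ p : ℝ × ℝ, (ppFreq β n ^ 2 + p.1 ^ 2) * (ppFreq β n ^ 2 + p.2 ^ 2) ^ 2 ≠ 0 := fun p => by positivity
  unfold ppKernelSummandDu
  exact hWe.mul ((Continuous.div ((hW1.mul (by fun_prop)).add (hWu.mul continuous_fst)) (by fun_prop) hne1).sub
    (Continuous.div ((hWu.mul (by fun_prop)).mul (by fun_prop)) (by fun_prop) hne2))

/-- **`R_M` is jointly continuous** in `(e,u)`. [cite: BenfattoGiulianiMastropietro2006, §2.1 (2.3)-(2.4)] -/
theorem continuous_ppTailKernel₂ {β : ℝ} (hβ : 0 < β) (Λ : ℝ) (M : ℕ) :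
    Continuous fun p : ℝ × ℝ => ppTailKernel β Λ M p.1 p.2 := by
  unfold ppTailKernel
  refine continuous_const.mul ?_
  refine continuous_tsum (fun n => (continuous_ppKernelSummand₂ hβ Λ (n + M)))
    ((summable_nat_add_iff M).2 ((summable_one_div_ppFreq_sq_add_sq hβ 0).mul_left 2)) fun n p => ?_
  rw [Real.norm_eq_abs]; exact abs_ppKernelSummand_le hβ Λ p.1 p.2 (n + M)

/-- **`∂ᵤR_M` is jointly continuous** in `(e,u)`. [cite: BenfattoGiulianiMastropietro2006, §2.1 (2.3)-(2.4)] -/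
theorem continuous_ppTailKernelDu₂ {β Λ : ℝ} (hβ : 0 < β) (hΛ : 0 < Λ) {B₁ : ℝ} (hB₁ : ∀ x, |deriv salmhoferCutoff x| ≤ B₁) (M : ℕ) :
    Continuous fun p : ℝ × ℝ => ppTailKernelDu β Λ M p.1 p.2 := by
  unfold ppTailKernelDu
  refine continuous_const.mul ?_
  refine continuous_tsum (fun n => (continuous_ppKernelSummandDu₂ hβ Λ (n + M)))
    ((summable_nat_add_iff M).2 ((summable_one_div_ppFreq_sq_add_sq hβ 0).mul_left (8 * B₁ / Λ + 5 / 2 * (β / π)))) fun n p => ?_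
  rw [Real.norm_eq_abs]; exact abs_ppKernelSummandDu_le hβ hΛ hB₁ p.1 p.2 (n + M)

/-! ## §3 The count-free tails -/

/-- **Generic tail**: if `|a n| ≤ C/ωₙ²` for all `n` (`C ≥ 0`) then `|Σ_k a (k+M)| ≤ C·β/(2ω_M)` — majorant `1/ωₙ² ≤ 2/(ωₙ²+ω_M²)` on `n ≥ M`, summed over ALL `n`
by `Σₙ 1/(ωₙ²+a²) = β·tanh(βa/2)/(4a) ≤ β/(4a)`. [cite: BenfattoGiulianiMastropietro2006, §2.1 (2.3)-(2.4)] -/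
theorem abs_tsum_tail_le_of_inv_sq {β : ℝ} (hβ : 0 < β) {C : ℝ} (hC : 0 ≤ C) {a : ℕ → ℝ}
    (ha : ∀ n, |a n| ≤ C * (1 / (ppFreq β n ^ 2 + 0 ^ 2))) (M : ℕ) :
    |∑' k : ℕ, a (k + M)| ≤ C * (β / (2 * ppFreq β M)) := by
  have hωM := ppFreq_pos hβ M
  set g : ℕ → ℝ := fun n => 2 * C * (1 / (ppFreq β n ^ 2 + ppFreq β M ^ 2)) with hg
  have hg0 : ∀ n, 0 ≤ g n := fun n => by positivity
  have hsg : Summable g := (summable_one_div_ppFreq_sq_add_sq hβ (ppFreq β M)).mul_left _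
  have hbd : ∀ k : ℕ, |a (k + M)| ≤ g (k + M) := fun k => by
    refine (ha (k + M)).trans ?_
    calc C * (1 / (ppFreq β (k + M) ^ 2 + 0 ^ 2)) ≤ C * (2 * (1 / (ppFreq β (k + M) ^ 2 + ppFreq β M ^ 2))) :=
          mul_le_mul_of_nonneg_left (ppFreq_tail_majorant hβ 0 M k) hC
      _ = g (k + M) := by simp only [hg]; ring
  have hsgs : Summable fun k : ℕ => g (k + M) := (summable_nat_add_iff M).2 hsg
  have hsf : Summable fun k : ℕ => a (k + M) := Summable.of_norm_bounded hsgs fun k => by rw [Real.norm_eq_abs]; exact hbd k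
  have htail : ∑' k : ℕ, g (k + M) ≤ ∑' n : ℕ, g n := by
    rw [← hsg.sum_add_tsum_nat_add M]
    have : 0 ≤ ∑ n ∈ Finset.range M, g n := Finset.sum_nonneg fun n _ => hg0 n
    linarith
  have hfull : ∑' n : ℕ, g n = 2 * C * (β * Real.tanh (β * ppFreq β M / 2) / (4 * ppFreq β M)) := by
    rw [hg, tsum_mul_left, tsum_one_div_ppFreq_sq_add_sq hβ hωM.ne']
  have ht : Real.tanh (β * ppFreq β M / 2) ≤ 1 := (Real.tanh_lt_one _).le
  calc |∑' k : ℕ, a (k + M)| ≤ ∑' k : ℕ, |a (k + M)| := by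
        have := norm_tsum_le_tsum_norm hsf.norm; simpa only [Real.norm_eq_abs] using this
    _ ≤ ∑' k : ℕ, g (k + M) := Summable.tsum_le_tsum hbd (by simpa only [Real.norm_eq_abs] using hsf.norm) hsgs
    _ ≤ ∑' n : ℕ, g n := htail
    _ = 2 * C * (β * Real.tanh (β * ppFreq β M / 2) / (4 * ppFreq β M)) := hfull
    _ ≤ 2 * C * (β * 1 / (4 * ppFreq β M)) := by gcongr
    _ = C * (β / (2 * ppFreq β M)) := by field_simp; ring

/-- **THE TAIL IS SMALL**: `|R_M(e,u)| ≤ 2/ω_M` for all levels (`ω_M = (2M+1)π/β`). [cite: BenfattoGiulianiMastropietro2006, §2.1 (2.3)-(2.4)] -/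
theorem abs_ppTailKernel_le {β : ℝ} (hβ : 0 < β) (Λ : ℝ) (M : ℕ) (e u : ℝ) :
    |ppTailKernel β Λ M e u| ≤ 2 / ppFreq β M := by
  have hωM := ppFreq_pos hβ M
  have h := abs_tsum_tail_le_of_inv_sq hβ (by norm_num : (0 : ℝ) ≤ 2) (fun n => abs_ppKernelSummand_le hβ Λ e u n) M
  have hβ2 : 0 < 2 / β := by positivity
  unfold ppTailKernel
  rw [abs_mul, abs_of_pos hβ2]
  calc 2 / β * |∑' k : ℕ, ppKernelSummand β Λ e u (k + M)| ≤ 2 / β * (2 * (β / (2 * ppFreq β M))) := mul_le_mul_of_nonneg_left h hβ2.le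
    _ = 2 / ppFreq β M := by field_simp

/-- **THE TAIL'S GRADIENT IS SMALL**: `|∂ᵤR_M(e,u)| ≤ (8B₁/Λ + (5/2)(β/π))/ω_M` for all levels. [cite: BenfattoGiulianiMastropietro2006, §2.1 (2.3)-(2.4)] -/
theorem abs_ppTailKernelDu_le {β Λ : ℝ} (hβ : 0 < β) (hΛ : 0 < Λ) {B₁ : ℝ} (hB₁ : ∀ x, |deriv salmhoferCutoff x| ≤ B₁) (M : ℕ) (e u : ℝ) :
    |ppTailKernelDu β Λ M e u| ≤ (8 * B₁ / Λ + 5 / 2 * (β / π)) / ppFreq β M := by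
  have hB0 := salmhoferB₁_nonneg hB₁
  have hωM := ppFreq_pos hβ M
  have hC : 0 ≤ 8 * B₁ / Λ + 5 / 2 * (β / π) := by positivity
  have h := abs_tsum_tail_le_of_inv_sq hβ hC (fun n => abs_ppKernelSummandDu_le hβ hΛ hB₁ e u n) M
  have hβ2 : 0 < 2 / β := by positivity
  unfold ppTailKernelDu
  rw [abs_mul, abs_of_pos hβ2]
  calc 2 / β * |∑' k : ℕ, ppKernelSummandDu β Λ e u (k + M)| ≤ 2 / β * ((8 * B₁ / Λ + 5 / 2 * (β / π)) * (β / (2 * ppFreq β M))) :=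
        mul_le_mul_of_nonneg_left h hβ2.le
    _ = (8 * B₁ / Λ + 5 / 2 * (β / π)) / ppFreq β M := by field_simp

/-- **`|∂ᵤR_M|` in `deriv` form**, the shape the remainder law consumes. [cite: BenfattoGiulianiMastropietro2006, §2.1 (2.3)-(2.4)] -/
theorem abs_deriv_ppTailKernel_u_le {β Λ : ℝ} (hβ : 0 < β) (hΛ : 0 < Λ) {B₁ : ℝ} (hB₁ : ∀ x, |deriv salmhoferCutoff x| ≤ B₁) (M : ℕ) (e u : ℝ) :
    |deriv (fun v => ppTailKernel β Λ M e v) u| ≤ (8 * B₁ / Λ + 5 / 2 * (β / π)) / ppFreq β M := by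
  rw [deriv_ppTailKernel_u hβ hΛ hB₁]; exact abs_ppTailKernelDu_le hβ hΛ hB₁ M e u

/-- **`|∂ₑR_M|`** — the same bound by symmetry. [cite: BenfattoGiulianiMastropietro2006, §2.1 (2.3)-(2.4)] -/
theorem abs_deriv_ppTailKernel_e_le {β Λ : ℝ} (hβ : 0 < β) (hΛ : 0 < Λ) {B₁ : ℝ} (hB₁ : ∀ x, |deriv salmhoferCutoff x| ≤ B₁) (M : ℕ) (e u : ℝ) :
    |deriv (fun x => ppTailKernel β Λ M x u) e| ≤ (8 * B₁ / Λ + 5 / 2 * (β / π)) / ppFreq β M := by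
  rw [(hasDerivAt_ppTailKernel_e hβ hΛ hB₁ M e u).deriv]; exact abs_ppTailKernelDu_le hβ hΛ hB₁ M u e

/-- The tail scales in closed form: `2/ω_M = 2β/((2M+1)π)` and `C/ω_M = C·β/((2M+1)π)` — `O(β/M)` constants. [folklore] -/
theorem div_ppFreq_eq {β : ℝ} (hβ : 0 < β) (C : ℝ) (M : ℕ) : C / ppFreq β M = C * β / ((2 * M + 1) * π) := by
  unfold ppFreq
  have hπ := Real.pi_pos
  field_simp

end Summit.HubbardSuperconductivity.HubbardSuperconductivity.Theorems.C4a

end
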